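import Literature.MathematicalPhysics.QuantumFieldTheory.Balaban1983to89.T4StabilitySocket

/-!
# `Balaban1983to89.T4StabilityFloor` — the (γ) FLOOR `c_low` of node U5c's stability socket
(`T4StabilitySocket.lowEnvelope_of_cor3With`, binder `hfloor : c₀ ≤ smallFieldMass`) DISCHARGED down to PRODUCT-HAAR
ARITHMETIC (kernel-proved: the bond ball `Π_b B` has mass `haar(B)^{#bonds}` and `#bonds(T₁^{(K)}) = 4(2L^m)^4` for EVERY
`K`) and POINTWISE binders of verbatim printed shape ((P1) `χ_K ≥ 1`, (P2) `A(U_K ·) ≤ a` on the ball; in §5 further: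
(2.17), (5), Thm 1 (8) of [Balaban1985Variational], the threshold order `B₃ε₁ ≤ ε_K`, the group-model inequality
`1 − Re tr h ≤ c_G|h − 1|²`, and the fine-plaquette budget `#plaquettes(T_η)·η⁴ = 6(2L^m)^4`, PROVED), so that the
floor becomes the EXPLICIT, `K`-UNIFORM number `c₀ = exp[−a/g²] · haar(B)^{4(2L^m)^4}`, `a = c_G(B₃ε₁)²n₄`
(cell `pub-balaban`, T4-DAG v23 §8 Q28 RULING R-U5c-GD, docket question (v) «is c_low printed-type?»; self-row
T4-U5c.E-NE7b-PROVE-P2j* (§8 Q24(a)), node U5c / U5.E, spine estimate NE7b, renewal member P2, generation 10; census item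
v24 of `t4/T4-EST-NE7b-P2.md`; v1.1 = + §6, same row; v1.2 = DOCSTRING-ONLY fold of the two v1.1 cross-reads, self-row
T4-U5c.E-NE7b-PROVE-P2k*, generation 11; kernel bookkeeping over `T4StabilitySocket` ONLY, no sibling module modified; the leaf
name avoids the FIBREWISE `T4SmallFieldFloor*` family of NE7c-P2, whose conditional floor (Y) is refuted at contact
slots — the floor here is GLOBAL, unconditional, at the final scale `k = K`, and shares nothing with (Y))

HONEST FRAMING (T4-DAG PAGE 1).  The cell's T4 target is the existence and uniqueness of the `ε → 0` limit of unit-scale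
block-averaged expectations on a FIXED finite torus, at rung (B)+1, CONDITIONAL on Bałaban's ultraviolet stability (B)
and on BetaPertH; it is NOT infinite volume, NOT the mass gap, NOT the Clay problem.  This module is [folklore] measure
theory (product measures of boxes), finite counting and real arithmetic.  NOTHING of Bałaban's is asserted: (B) enters
ONLY as the displayed hypothesis `(hB : B16.EndStatementBPrinted D.C)` / its unpacked `Cor3_250` conjunct
`(hcor : B16.Cor3With D.C γB em ep)`, the sign convention as `(hsign : B16.SignConventions D.C)`, and EVERY input of
printed type is a displayed, NAMED BINDER whose docstring quotes the located line it is the type of ((P1)/(P2), and in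
§5 `hchi`/`hwil`/`hreg`/`hε`/`hG`/`hcount`) — none is minted here as a fact, none is hidden in a definition; BetaPertH /
(B) / (B^μ) are hidden nowhere.  What the module records: the ONE denominator-side input of the (GD) currency that the
socket left as a named VALUE owed by the instantiating seat — R-U5c-GD (γ) «c_low» — is NOT a free constant: it is
`e^{−a/g²}` times a Haar-product mass, and everything `K`-dependent in it CANCELS by two counting identities proved
here.  NOT an estimate of Bałaban's; NOT summit progress; the numerator side of (GD) ((G3) «up», `bad_subset`,
`F_nonneg`, (G4)) and the relative price (FR) (walls G-ne7bp1-1 / G-ne7bp2-1) are untouched and stay with their owners.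

THE BOCHNER POINT (why the floor is NOT discharged through `smallFieldMass` on the primary route).  The socket's (γ) is
`c₀ ≤ smallFieldMass D K g₀ = ∫ χ_K e^{−A(U_K ·)/g_K²} dV_K`, an integral of ABSTRACT data (`χ`, `wilsonBG` are fields of
`B16.RunData`, measurable by no decree of the tree): were the integrand non-integrable the integral is the junk value `0`
and no floor is provable.  Route (ii) (primary, §3–§4) therefore bounds `∫ρ_K dV_K` DIRECTLY from the pointwise (2.50)
minorant on a measurable core set — `ρ_K` IS integrable (`T4StabilitySocket.integrable_dens_top`: its integral is
`c·Z_ε > 0`) — and re-proves the socket's `low`/`ratio` fields with the explicit `c₀`, in the socket's own shapes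
`nlowOf`/`constOf` VERBATIM, so `globalDom_of_lowEnvelope`, `regeneration_of_lowEnvelope`,
`exists_relWeightBound_of_lowEnvelopes` apply unchanged.  Route (i) (§3 `exp_neg_mul_measureReal_le_smallFieldMass`, §4
`floorOf_le_smallFieldMass`) gives the socket's LITERAL binder `floorOf … ≤ smallFieldMass …` under the displayed
integrability binder `hint`, for seats that hold measurability of the model's `χ_K`, `A(U_K ·)`.

THE PRINTED LINES THE BINDERS ARE THE TYPES OF (located; quotations verified on the cell's page renders
`b2b-balaban-ref1/pages/1985-cmp102-variational-background-p002/p003`, `1988-cmp119-convergent-renormalization-p004/p015`).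
[Balaban1985Variational] (B11) p. 278: (2) «|U(∂p) − 1| = |(∂U)(p) − 1| < ε₀L^{−2j} = ε₀η²(L^jη)^{−2} for p∈Ω_j, j = 0, 1, …, k»;
(5) «A(U) = A^η(U) = Σ_{p⊂Ω₀} η^{d−4}[1 − Re tr U(∂p)], η = L^{−k}»; (7) «|(∂V)(p′) − 1| < ε₁ for p′∈𝔅_k»; p. 279 Thm 1:
«There exist positive constants a₀, a₁, B₃, B₄(β₀), M(ε₁), B₃a₁ ≤ a₀, such that for an arbitrary configuration V satisfying
(7) with ε₁ ≤ a₁ there exists a minimal orbit in the space 𝔘_k({Ω_j}, B₃ε₁) ∩ 𝔅_k(𝔅_k, V). (8)», «The constants a₀, a₁,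
B₃, depend on d and L only», «Minimal configurations will be denoted by U_k(V), or U_k.» (tree `B11.Thm1Printed`, a
THEOREM of B11 with printed proof; the tree carries its statement shape, not its proof).  [Balaban1988Convergent] (B14)
p. 246: «in the first step we take ε₀ = g₀p₀(g₀), p₀(g₀) = A₀(log g₀⁻²)^{p₀}, p₀ ≥ 5r and A₀ is a sufficiently large
constant», «ε₁ = g₁p₀(g₁)» (tree `p0Profile`, `epsK`); p. 257: (2.16) «U_{k,□}(V_k) = U(B_k(□~⁴), M˙(Q_k^{s*}V_k))», (2.17)
«χ_k(Ω_k) = Π_{□⊂Ω_k} χ({sup_{p⊂□~}|U_{k,□}(V_k,∂p) − 1| < ε_kη²})» (tree quotation at `Step` (2.17)/(2.18)); Cor. 3 (2.50)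
p. 264 enters BY NAME only (`B16.Cor3With`, the socket's input; NEVER the k-uniform reading `B16.UVBound01`, refuted by
`B16B10Shape.not_uvBound01_of_smallCouplings`).  The product Haar measure `dU = Π_b dU(b)` is the tree's `fieldMeasure :=
Measure.pi (fun _ : PBond P j => haar)` ([Balaban1985Averaging] (10)); `|T₁^{(K)}|`, `#bonds`, `#plaquettes` are read off
`Missing.params4` / `T4Family.P` ([Balaban1987RG1] (0.1) p. 251: the torus of side `2L^m` is FIXED, the `K`-th run has
`K` steps).

WHAT IS PROVED (0 `sorry`; every declaration [folklore] bookkeeping unless its docstring cites the located display).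
§1 (L3) `ρ ≥ 0` integrable, `ρ ≥ c` on a measurable `S` ⟹ `c·μ(S) ≤ ∫ρ`; (L3′) `χ ≥ 0`, `χe^{−S−e} ≤ ρ` pointwise, `ρ`
   integrable, and on a measurable `T`: `χ ≥ 1`, `S ≤ s` ⟹ `e^{−(s+e)}·μ(T) ≤ ∫ρ` — NO measurability of `χ`, `S`.
§2 `bondBall P j B := {U | ∀ b, U b ∈ B}` `= Π_b B` (`bondBall_eq_pi`), measurable for measurable `B`;
   `card_pbond : #PBond P j = (sitesPerDir j)^d · d`; **`fieldMeasure_bondBall : μ(Π_b B) = haar(B)^{#bonds}`**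
   (`Measure.pi_pi`) and its real form; `unitBondCount F := 4(2L^m)^4` with **`card_pbond_top : #PBond (F.P K) K =
   unitBondCount F` for EVERY `K`**; hence `fieldMeasure_real_bondBall_top : μ_K(Π_b B) = haar(B)^{unitBondCount F}` —
   the SAME number at the final scale of every run.
§3 One run `⟨K, m, g₀⟩`, final scale: route (i) `exp_neg_mul_measureReal_le_smallFieldMass` (under `hint`); route (ii)
   **`exp_neg_mul_measureReal_le_integral_dens`**: `exp[−(a/g_K² + e₋(g_K)|T₁^{(K)}|)]·μ_K(S) ≤ ∫ρ_K dV_K` from `hcor`,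
   `InInterval γB K`, (P1), (P2) on a measurable `S`; and the (G2) chain `dressed_lower_core` (… `≤ ∫e^{tF}ρ₀ dU` via
   `FiniteEpsData.integral_dens_eq_zero` and `T4StabilitySocket.exp_neg_mul_integral_dens_zero_le` BY NAME).
§4 `floorOf g a θ := e^{−a/g²}·θ` (`floorOf_pos`); `floorOf_le_smallFieldMass` (route (i), the socket's literal `hfloor`
   shape); **`lowEnvelope_of_cor3With_core`** = the socket's `lowEnvelope_of_cor3With` with `(hc₀, hfloor)` REPLACED by a
   measurable core-set family `S K` of mass `≥ θ > 0` carrying (P1)/(P2), conclusion `LowEnvelope l₀ T A (nlowOf l₀ B e₋⁺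
   n₁ (floorOf g a θ)) nup (constOf l₀ B e₋⁺ n₁ (floorOf g a θ) Nup) K₀`; **`lowEnvelope_of_cor3With_ball`**: `S K` = the
   bond balls of ONE measurable one-bond set `B` with `haar(B) > 0` — the mass hypothesis DISAPPEARS (§2) and
   `c₀ = floorOf g a (haar(B)^{unitBondCount F})`; the pin form **`lowEnvelope_of_endStatementBPrinted_ball`** in the
   quantifier order of `T4ContinuumYM4Torus.ForSmallCouplings` (as the socket's headline, floor binders in place of
   `c₀`); `globalDom_of_cor3With_ball` (numerator fields from their owners ⟹ `GlobalDom` with the explicit floor).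
§5 `pointwise_of_reading`: (P1) and (P2) with `a = c_G(B₃ε₁)²n₄` FROM the binders `hchi` [(2.17)-type], `hwil`
   [(5)-type], `hreg` [Thm 1 (8) with (2) at `j = k`, on the core set], `hε` [`B₃ε₁ ≤ ε_K`], `hG`/`hcG` [group model],
   `hcount` [`#Fine·η⁴ ≤ n₄`]; the counts `card_plaq : #Plaq P j = (sitesPerDir j)^d · #{μ<ν}` (six planes in `d = 4`, by
   `decide`), `card_plaq_fine : #Plaq (F.P K) 0 = 6(2L^{m+K})^4`, **`card_plaq_fine_mul_eta_pow : #Plaq (F.P K) 0 · η_K⁴ = 6(2L^m)^4`**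
   (`η_K = L^{−K}`, tree `Params.eta`) — so `n₄ := 6(2L^m)^4` serves EVERY `K` with equality; and the end-to-end
   **`lowEnvelope_of_cor3With_reading`** (bond-ball form ∘ `pointwise_of_reading`), whose floor
   `exp[−c_G(B₃ε₁)²n₄/g²]·haar(B)^{4(2L^m)^4}` contains NO named constant of the node.
§6 (v1.1, APPEND-ONLY; item O-R13 of the U5 referee's RULING R-GD-2, `t4/T4-REF-U5.md` §16, = XREAD note N-1 on v1)
   TWO PLAQUETTE FAMILIES.  In print the characteristic function of (2.50) is (2.17)'s, built from the plaquette
   variables of the LOCALISED minimal configurations `U_{k,□}` of [Balaban1988Convergent] (2.16) p. 257, whereas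
   `A(U_k(V_k))` in (2.50) and (8) of [Balaban1985Variational] Thm 1 concern the GLOBAL minimiser `U_k` — two families,
   where §5 shares ONE family `plaq` between `hchi` and `hwil`/`hreg` (so no single dictionary discharges §5's three
   binders verbatim AT ONCE; flagged in v1's docstring of `pointwise_of_reading`, VALUE unaffected).  §6 separates them:
   `p1_of_reading` ((P1) from a localised family `plaqLoc : GaugeField → FineLoc → G` ALONE — `hchi` on `plaqLoc`,
   `hregLoc` = (8)-type regularity of the localised minimisers on the core set, `hε`; no finiteness or count of `FineLoc`
   needed), `p2_of_reading` ((P2) from the global family ALONE — `hwil`, `hG`/`hcG`, `hcount`, `hreg`),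
   `pointwise_of_reading₂` (both), **`lowEnvelope_of_cor3With_reading₂`** (bond-ball form ∘ the two; SAME floor
   `floorOf g (c_G(B₃ε₁)²n₄) (haar(B)^{unitBondCount F})` as `lowEnvelope_of_cor3With_reading` — only the binder list
   changes).  The print sentence giving (8) for the localised `U_{K,□} = U(𝐁_K(□^{~4}), ·)` (determining-set minimal
   configurations, (2.13) p. 257) is to be LOCATED by the dictionary seat or booked [R] (R-GD-2 P-6) — `hregLoc` is a
   displayed binder, asserted nowhere.  §§1–5 are byte-identical to v1 (p190730).
   v1.2 (DOCSTRING-ONLY; self-row T4-U5c.E-NE7b-PROVE-P2k*, generation 11; folds XREAD t4-ref3-g27 D1 LOW and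
   pv06-g22 INFO I-2/I-3 — every declaration and proof byte-identical to v1.1 (p191006)): (a) the cubes `□` of
   (2.16)/(2.17) are the cubes of the partition of `T_η` into `LM₂R_K`-cubes (p. 257), NOT unit-lattice cubes (v1.1's
   gloss in the docstring of `p1_of_reading`, corrected; VALUE unaffected — `FineLoc` is an arbitrary type); (b) `FineLoc`
   may be ANY type: print's index family (cubes `□`, plaquettes `p ⊂ □~`) is FINITE, and for a finite family the binder's
   `∀ q, |…| < ε_Kη²` IS print's `sup < ε_Kη²` (for an infinite one it would be marginally stronger than (2.17) — not
   print's situation; the instantiating seat takes `FineLoc` := the actual finite family); (c) the U5 referee's LOCATION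
   POINTER for `hregLoc` (the one print-owed step of R-GD-2 P-6, obligation unchanged): [Balaban1985Variational] Thm 1
   (8) itself, read at `𝔅 := 𝐁_K(□^{~4})` and at the configuration `V′ := M˙(Q_K^{s*}V_K)` restricted there
   ([Balaban1988Convergent] (2.13)/(2.16), (1.3)), CONDITIONAL on Thm 1's hypothesis (7) holding for `V′` when `V_K` lies
   in the bond ball — the check of (7) for `V′` is the dictionary seat's one located step [R] (for the GLOBAL family, (7)
   for `V_K` itself on the bond ball is interface arithmetic, `dist1_mul_le`/`dist1_inv`: the model leaf
   `T4StabilityFloorUnitary` §5 (v1.2) displays (7) and discharges it in the kernel).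

DOCKET HONESTY (R-U5c-GD (γ); referee ruling R-GD-1, `t4/T4-REF-U5.md` §10, item (iii) «the χ_K-constrained integral
lower bound»; docket question (v)).  ANSWER TYPED HERE: `c_low` is PRINTED-TYPE MODULO A DICTIONARY, namely — kernel-proved:
the Haar-product mass and both `K`-cancellations (`#bonds(T₁^{(K)})`, `#plaquettes(T_η)·η⁴`), the integration without
measurability, the assembly into the socket's fields; displayed binders, each the type of ONE located printed line and
each owed by the seat holding the model dictionary (that the abstract `χ_K` of `B16.RunData` IS (2.17)'s function of the
minimiser's plaquette variables, that `wilsonBG` IS (5) at `U = U_K(V)`, that the minimiser of B11 Thm 1 IS the `U_K` of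
(2.50) — READINGS of the construction, not assertions of this file): (P1) ⇐ `hchi` ∘ `hreg` ∘ `hε`, (P2) ⇐ `hwil` ∘ `hreg`
∘ `hG` ∘ `hcount`; and two MODEL facts over the abstract `GaugeGroup`/`HaarData` interfaces, which carry no such axioms:
`haar(B) > 0` for the chosen one-bond neighbourhood `B` of `1` (Haar measure of a non-empty open set of a compact Lie
group) and `1 − Re tr h ≤ c_G|h − 1|²`.  GRADES: B11 Thm 1 is theorem-grade in print (proved in B11; its proof is not
re-derived in the tree); (2.17), (5), p. 246 are DEFINITIONS in print; (2.50)-lower keeps the grade the socket records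
(printed-asserted, derivation in d = 4 not in the printed pages, cell gap G-adv3-2) and stays LOAD-BEARING for U5c under
(GD).  The bond-ball radius bookkeeping «all `|V(b) − 1| < τ` ⟹ (7) with `ε₁ = 4τ`» is the tree's
`T4ExpWindowSmallField` §1 («bond-small ⟹ plaquette-small», from `dist1_mul_le`, `dist1_inv`) and is cited, not imported.

Deliberately NOT here: the model dictionary itself (instantiating / apex seat: `T4ConcreteRealisation`, `UnitaryModel`);
the VALUE of `haar(B)` or of `c_G` in `SU(N)`; the identification (α) (H2 / R2 owners); anything on the numerator side
((G3)/(G4): `T4PrintedShapeBanking`, `T4PersistenceDictionary` / `T4BankedInduction`, `T4RenewalChains` /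
`T4RecordChains` / `T4LiveStructureGas`); the fibre-relative chain (`EventDom`, wall G-ne7bp2-1) and the marginal currency
(`T4MarginalRenewal`), which need no floor and are unaffected.
-/

open MeasureTheory Filter Topology
open scoped BigOperators ENNReal

universe u

namespace Literature.MathematicalPhysics.QuantumFieldTheory.Balaban1983to89.T4StabilityFloor

open Missing T4Continuum T4WeightBudget T4GlobalDenominator T4LiveClassFibration T4StabilitySocket

/-! ## §1 Two generic integral inequalities: a pointwise floor on a measurable core set integrates -/

section Generic

variable {X : Type*} [MeasurableSpace X] {μ : Measure X} [IsFiniteMeasure μ]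

/-- (L3) For a finite measure: `ρ ≥ 0` integrable, `ρ ≥ c` on a measurable set `S` `⟹ c · μ(S) ≤ ∫ ρ` (the integral
of the indicator `𝟙_S · c` is `μ(S) · c`, and `𝟙_S · c ≤ ρ` pointwise). [folklore] -/
theorem const_mul_measureReal_le_integral {ρ : X → ℝ} {S : Set X} (hS : MeasurableSet S) {c : ℝ}
    (hρ0 : ∀ x, 0 ≤ ρ x) (hρS : ∀ x ∈ S, c ≤ ρ x) (hρ : Integrable ρ μ) :
    c * μ.real S ≤ ∫ x, ρ x ∂μ := by
  have h1 : c * μ.real S = ∫ x, S.indicator (fun _ => c) x ∂μ := by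
    rw [integral_indicator_const c hS, smul_eq_mul, mul_comm]
  rw [h1]
  classical
  refine integral_mono ((integrable_const c).indicator hS) hρ fun x => ?_
  show S.indicator (fun _ => c) x ≤ ρ x
  rw [Set.indicator_apply]
  split_ifs with hx
  · exact hρS x hx
  · exact hρ0 x

/-- (L3′) The printed shape: `χ ≥ 0`, `χ·e^{−S−e} ≤ ρ` pointwise, `ρ` integrable, and ON a measurable set `T`:
`χ ≥ 1` and `S ≤ s` `⟹ e^{−(s+e)} · μ(T) ≤ ∫ ρ`.  No measurability of `χ` or `S` is needed (contrast the socket's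
(L1), which lower-bounds `∫ρ` by the INTEGRAL `∫χe^{−S}` and therefore meets the Bochner junk value when `χe^{−S}` is
not integrable). [folklore] -/
theorem exp_neg_mul_measureReal_le_integral_of_pointwise {ρ χ S : X → ℝ} {e s : ℝ} {T : Set X}
    (hT : MeasurableSet T) (hχ : ∀ x, 0 ≤ χ x) (hpt : ∀ x, χ x * Real.exp (-S x - e) ≤ ρ x)
    (hρ : Integrable ρ μ) (hχT : ∀ x ∈ T, 1 ≤ χ x) (hST : ∀ x ∈ T, S x ≤ s) :
    Real.exp (-(s + e)) * μ.real T ≤ ∫ x, ρ x ∂μ := by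
  refine const_mul_measureReal_le_integral hT (fun x => ?_) (fun x hx => ?_) hρ
  · exact (mul_nonneg (hχ x) (Real.exp_nonneg _)).trans (hpt x)
  · calc Real.exp (-(s + e)) = 1 * Real.exp (-s - e) := by rw [one_mul, neg_add']
      _ ≤ χ x * Real.exp (-S x - e) :=
          mul_le_mul (hχT x hx) (Real.exp_le_exp.mpr (by linarith [hST x hx])) (Real.exp_nonneg _) (hχ x)
      _ ≤ ρ x := hpt x

end Generic

/-! ## §2 Product-Haar arithmetic: the bond ball, its mass `θ^{#bonds}`, and the `K`-independent bond count of `T₁^{(K)}` -/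

section ProductHaar

variable {P : Params} {j : ℕ} {G : Type*} [GaugeGroup G] [MeasurableSpace G] [HaarData G]

/-- THE BOND BALL of a one-bond set `B ⊆ G`: the gauge fields on `T^{(j)}` ALL of whose bond variables lie in `B`
(for `B = {h | dist1 h < τ}` this is "every `U(b)` within `τ` of the identity"). [folklore] -/
def bondBall (P : Params) (j : ℕ) (B : Set G) : Set (GaugeField P j G) := {U | ∀ b, U b ∈ B}

omit [GaugeGroup G] [MeasurableSpace G] [HaarData G] in
/-- Membership in the bond ball, unfolded. [folklore] -/
@[simp] theorem mem_bondBall {B : Set G} {U : GaugeField P j G} : U ∈ bondBall P j B ↔ ∀ b, U b ∈ B := Iff.rfl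

omit [GaugeGroup G] [MeasurableSpace G] [HaarData G] in
/-- The bond ball is the product set `Π_b B`. [folklore] -/
theorem bondBall_eq_pi (B : Set G) : bondBall P j B = Set.pi Set.univ (fun _ : PBond P j => B) :=
  Set.ext fun _ => Iff.intro (fun h b _ => h b) (fun h b => h b (Set.mem_univ b))

omit [GaugeGroup G] [HaarData G] in
/-- The bond ball of a measurable one-bond set is measurable (finitely many bonds). [folklore] -/
theorem measurableSet_bondBall {B : Set G} (hB : MeasurableSet B) : MeasurableSet (bondBall P j B) := by
  rw [bondBall_eq_pi]
  exact MeasurableSet.univ_pi fun _ => hB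

omit [GaugeGroup G] [MeasurableSpace G] [HaarData G] in
/-- THE BOND COUNT of `T^{(j)}`: `#bonds = |T^{(j)}| · d = (sitesPerDir j)^d · d` (a positively oriented bond is a
pair (site, direction); tree `Site.card_site`). [folklore] -/
theorem card_pbond (P : Params) (j : ℕ) : Fintype.card (PBond P j) = P.sitesPerDir j ^ P.d * P.d := by
  rw [Fintype.card_congr (⟨fun b => (b.src, b.dir), fun p => ⟨p.1, p.2⟩, fun _ => rfl, fun _ => rfl⟩ :
    PBond P j ≃ Site P j × Fin P.d), Fintype.card_prod, Site.card_site, Fintype.card_fin]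

/-- THE MASS OF THE BOND BALL under the product Haar measure `dU = Π_b dU(b)` (tree `fieldMeasure` IS `Measure.pi` of
copies of `HaarData.haar`): `μ(Π_b B) = haar(B)^{#bonds}` (Mathlib `Measure.pi_pi`). [folklore] -/
theorem fieldMeasure_bondBall (B : Set G) :
    fieldMeasure P j G (bondBall P j B) = (HaarData.haar (G := G)) B ^ Fintype.card (PBond P j) := by
  rw [bondBall_eq_pi]
  exact (Measure.pi_pi (fun _ : PBond P j => (HaarData.haar : Measure G)) (fun _ => B)).trans
    (by rw [Finset.prod_const, Finset.card_univ])

/-- The same in real numbers: `μ(Π_b B) = θ^{#bonds}`, `θ = haar(B) ∈ [0, 1]`. [folklore] -/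
theorem fieldMeasure_real_bondBall (B : Set G) :
    (fieldMeasure P j G).real (bondBall P j B) = (HaarData.haar (G := G)).real B ^ Fintype.card (PBond P j) := by
  rw [measureReal_def, measureReal_def, fieldMeasure_bondBall, ENNReal.toReal_pow]

/-- Sanity value: the bond ball of the whole group is everything and has mass `1`. [folklore] -/
theorem fieldMeasure_bondBall_univ : fieldMeasure P j G (bondBall P j (Set.univ : Set G)) = 1 := by
  rw [fieldMeasure_bondBall, measure_univ, one_pow]

/-- THE BOND COUNT OF THE UNIT LATTICE `T₁^{(K)}` of the torus of side `2L^m` in `d = 4`: `4 · (2L^m)^4` — ONE natural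
number for the whole family `K ↦ F.P K` ([Balaban1987RG1] (0.1) p. 251: the `K`-th approximation has `K` steps and
ends on the unit lattice of the fixed torus; tree `T4Family.P`, `Params.sitesPerDir K = 2L^{m+K−K}`). [cite: Balaban1987RG1, (0.1) p.251] -/
def unitBondCount (F : T4Family) : ℕ := (2 * F.L ^ F.m) ^ 4 * 4

omit [GaugeGroup G] [MeasurableSpace G] [HaarData G] in
/-- `#bonds(T₁^{(K)}) = unitBondCount F` for EVERY `K` (the type `PBond (F.P K) K` depends on `K`, its cardinality
does not). [folklore] -/
theorem card_pbond_top (F : T4Family) (K : ℕ) : Fintype.card (PBond (F.P K) K) = unitBondCount F := by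
  rw [card_pbond, unitBondCount]
  simp [Params.sitesPerDir]

omit [GaugeGroup G] [MeasurableSpace G] [HaarData G] in
/-- `unitBondCount F > 0`. [folklore] -/
theorem unitBondCount_pos (F : T4Family) : 0 < unitBondCount F := by
  have hL : 0 < F.L := by have := F.hL.2; omega
  unfold unitBondCount
  positivity

/-- THE `K`-UNIFORM MASS of the bond ball at the final scale of the `K`-th run: `μ_K(Π_b B) = θ^{unitBondCount F}`,
the SAME number for every `K`. [folklore] -/
theorem fieldMeasure_real_bondBall_top (F : T4Family) (K : ℕ) (B : Set G) :
    (fieldMeasure (F.P K) K G).real (bondBall (F.P K) K B) = (HaarData.haar (G := G)).real B ^ unitBondCount F := by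
  rw [fieldMeasure_real_bondBall, card_pbond_top]

end ProductHaar

/-! ## §3 The final scale of ONE run: (2.50)-lower on a core set, integrated WITHOUT measurability of `χ_K`, `A(U_K ·)` -/

section FinalScale

variable {F : T4Family} {G : Type*} [GaugeGroup G] [MeasurableSpace G] [HaarData G]

/-- ROUTE (i) — THE SOCKET'S OWN CURRENCY.  If the small-field Wilson weight `χ_K · e^{−A(U_K ·)/g_K²}` (transported by
`real.cfg`) is INTEGRABLE (binder `hint`: it is not measurable by decree in the tree, `χ`, `wilsonBG` being abstract data
of the construction), then on any measurable core set `S` where `χ_K ≥ 1` (P1) and `A(U_K ·) ≤ a` (P2):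
`e^{−a/g_K²} · μ_K(S) ≤ c_low(K) = smallFieldMass D K g₀` — literally the shape of the socket's binder `hfloor`. [folklore] -/
theorem exp_neg_mul_measureReal_le_smallFieldMass (D : FiniteEpsData F G) (hsign : B16.SignConventions D.C)
    (K : ℕ) (g₀ : ℝ) {S : Set (GaugeField (F.P K) K G)} (hS : MeasurableSet S) {a : ℝ}
    (hχ : ∀ V ∈ S, 1 ≤ (D.C ⟨K, F.m, g₀⟩).χ K ((D.real.cfg K g₀ K).symm V))
    (hA : ∀ V ∈ S, (D.C ⟨K, F.m, g₀⟩).wilsonBG K ((D.real.cfg K g₀ K).symm V) ≤ a)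
    (hint : Integrable (fun V => (D.C ⟨K, F.m, g₀⟩).χ K ((D.real.cfg K g₀ K).symm V) *
      Real.exp (-(1 / ((D.C ⟨K, F.m, g₀⟩).flow.g K) ^ 2 *
        (D.C ⟨K, F.m, g₀⟩).wilsonBG K ((D.real.cfg K g₀ K).symm V)))) (fieldMeasure (F.P K) K G)) :
    Real.exp (-(1 / ((D.C ⟨K, F.m, g₀⟩).flow.g K) ^ 2 * a)) * (fieldMeasure (F.P K) K G).real S ≤
      smallFieldMass D K g₀ := by
  have hg : 0 ≤ 1 / ((D.C ⟨K, F.m, g₀⟩).flow.g K) ^ 2 := by positivity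
  refine const_mul_measureReal_le_integral hS (fun V => mul_nonneg (hsign _ _ _) (Real.exp_nonneg _))
    (fun V hV => ?_) hint
  calc Real.exp (-(1 / ((D.C ⟨K, F.m, g₀⟩).flow.g K) ^ 2 * a))
      = 1 * Real.exp (-(1 / ((D.C ⟨K, F.m, g₀⟩).flow.g K) ^ 2 * a)) := (one_mul _).symm
    _ ≤ (D.C ⟨K, F.m, g₀⟩).χ K ((D.real.cfg K g₀ K).symm V) *
          Real.exp (-(1 / ((D.C ⟨K, F.m, g₀⟩).flow.g K) ^ 2 *
            (D.C ⟨K, F.m, g₀⟩).wilsonBG K ((D.real.cfg K g₀ K).symm V))) :=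
        mul_le_mul (hχ V hV) (Real.exp_le_exp.mpr (by nlinarith [hA V hV])) (Real.exp_nonneg _) (hsign _ _ _)

variable [RegularGaugeGroup G]

/-- ROUTE (ii) — **(2.50)-LOWER AT THE FINAL SCALE, INTEGRATED OVER A CORE SET** (no integrability binder).  From
`Cor3With D.C γB em ep` BY NAME (the `Cor3_250` conjunct of the pin, unpacked) and the run's interval hypothesis:
pointwise `χ_K·exp[−A(U_K(V))/g_K² − e₋(g_K)|T₁^{(K)}|] ≤ ρ_K(V)`, and `ρ_K ≥ 0` is integrable (`integrable_dens_top`: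
its integral is `c·Z_ε > 0`); so on a measurable core set `S` with (P1) `χ_K ≥ 1`, (P2) `A(U_K ·) ≤ a`:
`exp[−(a/g_K² + e₋(g_K)|T₁^{(K)}|)] · μ_K(S) ≤ ∫ ρ_K dV_K`. [cite: Balaban1988Convergent, Cor. 3 (2.50) p.264] -/
theorem exp_neg_mul_measureReal_le_integral_dens (D : FiniteEpsData F G) (hsign : B16.SignConventions D.C)
    {γB : ℝ} {em ep : ℝ → ℝ} (hcor : B16.Cor3With D.C γB em ep) (K : ℕ) (g₀ : ℝ)
    (hI : (D.C ⟨K, F.m, g₀⟩).flow.InInterval γB K)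
    {S : Set (GaugeField (F.P K) K G)} (hS : MeasurableSet S) {a : ℝ}
    (hχ : ∀ V ∈ S, 1 ≤ (D.C ⟨K, F.m, g₀⟩).χ K ((D.real.cfg K g₀ K).symm V))
    (hA : ∀ V ∈ S, (D.C ⟨K, F.m, g₀⟩).wilsonBG K ((D.real.cfg K g₀ K).symm V) ≤ a) :
    Real.exp (-(1 / ((D.C ⟨K, F.m, g₀⟩).flow.g K) ^ 2 * a +
        em ((D.C ⟨K, F.m, g₀⟩).flow.g K) * ((D.C ⟨K, F.m, g₀⟩).numSites K : ℝ))) *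
      (fieldMeasure (F.P K) K G).real S ≤ ∫ V, D.dens K g₀ K V ∂fieldMeasure (F.P K) K G := by
  have hpt : ∀ V : GaugeField (F.P K) K G,
      (D.C ⟨K, F.m, g₀⟩).χ K ((D.real.cfg K g₀ K).symm V) *
          Real.exp (-(1 / ((D.C ⟨K, F.m, g₀⟩).flow.g K) ^ 2 *
              (D.C ⟨K, F.m, g₀⟩).wilsonBG K ((D.real.cfg K g₀ K).symm V)) -
            em ((D.C ⟨K, F.m, g₀⟩).flow.g K) * ((D.C ⟨K, F.m, g₀⟩).numSites K : ℝ)) ≤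
        D.dens K g₀ K V :=
    fun V => (hcor ⟨K, F.m, g₀⟩ hI K le_rfl ((D.real.cfg K g₀ K).symm V)).1
  have hg : 0 ≤ 1 / ((D.C ⟨K, F.m, g₀⟩).flow.g K) ^ 2 := by positivity
  exact exp_neg_mul_measureReal_le_integral_of_pointwise (μ := fieldMeasure (F.P K) K G)
    (S := fun V => 1 / ((D.C ⟨K, F.m, g₀⟩).flow.g K) ^ 2 *
      (D.C ⟨K, F.m, g₀⟩).wilsonBG K ((D.real.cfg K g₀ K).symm V))
    hS (fun V => hsign _ _ _) hpt (integrable_dens_top D K g₀) hχ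
    (fun V hV => mul_le_mul_of_nonneg_left (hA V hV) hg)

/-- **THE (G2) CHAIN OF ONE RUN ON A CORE SET**: (2.50)-lower at `k = K` integrated over `S`, `∫ρ_K dV_K = ∫ρ₀ dU`
((0.4) + push-forward, `FiniteEpsData.integral_dens_eq_zero` BY NAME), then the source (`|F| ≤ B` measurable):
`e^{−|t|B} · exp[−(a/g_K² + e₋(g_K)|T₁^{(K)}|)] · μ_K(S) ≤ ∫ e^{tF(U)} ρ₀(U) dU`. [folklore] -/
theorem dressed_lower_core (D : FiniteEpsData F G) (hsign : B16.SignConventions D.C)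
    {γB : ℝ} {em ep : ℝ → ℝ} (hcor : B16.Cor3With D.C γB em ep) (K : ℕ) (g₀ : ℝ)
    (hI : (D.C ⟨K, F.m, g₀⟩).flow.InInterval γB K)
    {S : Set (GaugeField (F.P K) K G)} (hS : MeasurableSet S) {a : ℝ}
    (hχ : ∀ V ∈ S, 1 ≤ (D.C ⟨K, F.m, g₀⟩).χ K ((D.real.cfg K g₀ K).symm V))
    (hA : ∀ V ∈ S, (D.C ⟨K, F.m, g₀⟩).wilsonBG K ((D.real.cfg K g₀ K).symm V) ≤ a)
    {obs : GaugeField (F.P K) 0 G → ℝ} {B : ℝ} (hobs : Measurable obs) (hbd : ∀ U, |obs U| ≤ B) (t : ℝ) :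
    Real.exp (-(|t| * B)) *
        (Real.exp (-(1 / ((D.C ⟨K, F.m, g₀⟩).flow.g K) ^ 2 * a +
            em ((D.C ⟨K, F.m, g₀⟩).flow.g K) * ((D.C ⟨K, F.m, g₀⟩).numSites K : ℝ))) *
          (fieldMeasure (F.P K) K G).real S) ≤
      ∫ U, Real.exp (t * obs U) * D.dens K g₀ 0 U ∂fieldMeasure (F.P K) 0 G :=
  calc Real.exp (-(|t| * B)) *
        (Real.exp (-(1 / ((D.C ⟨K, F.m, g₀⟩).flow.g K) ^ 2 * a +
            em ((D.C ⟨K, F.m, g₀⟩).flow.g K) * ((D.C ⟨K, F.m, g₀⟩).numSites K : ℝ))) *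
          (fieldMeasure (F.P K) K G).real S)
      ≤ Real.exp (-(|t| * B)) * ∫ V, D.dens K g₀ K V ∂fieldMeasure (F.P K) K G :=
        mul_le_mul_of_nonneg_left (exp_neg_mul_measureReal_le_integral_dens D hsign hcor K g₀ hI hS hχ hA)
          (Real.exp_nonneg _)
    _ = Real.exp (-(|t| * B)) * ∫ U, D.dens K g₀ 0 U ∂fieldMeasure (F.P K) 0 G := by
        rw [D.integral_dens_eq_zero K g₀ K le_rfl]
    _ ≤ _ := exp_neg_mul_integral_dens_zero_le D K g₀ hobs hbd t

end FinalScale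

/-! ## §4 THE FLOOR: `LowEnvelope` with the EXPLICIT `c₀ = e^{−a/g²} · θ^{unitBondCount F}` -/

section Floor

/-- THE FLOOR CONSTANT `floorOf g a θ := e^{−a/g²} · θ` (in the ball form `θ = haar(B)^{unitBondCount F}`): the value
that replaces the socket's NAMED floor `c₀` (binder (γ) of R-U5c-GD). [folklore] -/
noncomputable def floorOf (g a θ : ℝ) : ℝ := Real.exp (-(1 / g ^ 2 * a)) * θ

/-- `floorOf g a θ > 0` as soon as `θ > 0`. [folklore] -/
theorem floorOf_pos {g a θ : ℝ} (hθ : 0 < θ) : 0 < floorOf g a θ := mul_pos (Real.exp_pos _) hθ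

/-- `floorOf` unfolded. [folklore] -/
theorem floorOf_eq (g a θ : ℝ) : floorOf g a θ = Real.exp (-(1 / g ^ 2 * a)) * θ := rfl

variable {F : T4Family} {G : Type*} [GaugeGroup G] [MeasurableSpace G] [HaarData G]

/-- **THE FLOOR IN THE SOCKET'S OWN CURRENCY (route (i), one run)**: under the integrability binder of
`exp_neg_mul_measureReal_le_smallFieldMass`, with (P1)/(P2) on the bond ball of a measurable one-bond set `B`:
`floorOf g_K a (haar(B)^{unitBondCount F}) ≤ smallFieldMass D K g₀` — i.e. the socket's `hfloor` with `c₀ := floorOf g a θ^{n_b}`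
once `g_K = g` (tuning). [folklore] -/
theorem floorOf_le_smallFieldMass (D : FiniteEpsData F G) (hsign : B16.SignConventions D.C) (K : ℕ) (g₀ : ℝ)
    {Bset : Set G} (hB : MeasurableSet Bset) {a : ℝ}
    (hχ : ∀ V : GaugeField (F.P K) K G, (∀ b, V b ∈ Bset) → 1 ≤ (D.C ⟨K, F.m, g₀⟩).χ K ((D.real.cfg K g₀ K).symm V))
    (hA : ∀ V : GaugeField (F.P K) K G, (∀ b, V b ∈ Bset) →
      (D.C ⟨K, F.m, g₀⟩).wilsonBG K ((D.real.cfg K g₀ K).symm V) ≤ a)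
    (hint : Integrable (fun V => (D.C ⟨K, F.m, g₀⟩).χ K ((D.real.cfg K g₀ K).symm V) *
      Real.exp (-(1 / ((D.C ⟨K, F.m, g₀⟩).flow.g K) ^ 2 *
        (D.C ⟨K, F.m, g₀⟩).wilsonBG K ((D.real.cfg K g₀ K).symm V)))) (fieldMeasure (F.P K) K G)) :
    floorOf ((D.C ⟨K, F.m, g₀⟩).flow.g K) a ((HaarData.haar (G := G)).real Bset ^ unitBondCount F) ≤
      smallFieldMass D K g₀ := by
  rw [floorOf_eq, ← fieldMeasure_real_bondBall_top F K Bset]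
  exact exp_neg_mul_measureReal_le_smallFieldMass D hsign K g₀ (measurableSet_bondBall hB)
    (fun V hV => hχ V hV) (fun V hV => hA V hV) hint

variable [RegularGaugeGroup G]

/-- **THE (G2)/(G5) SOCKET WITH ITS FLOOR DISCHARGED — core-set form (route (ii), no integrability binder).**  One
`FiniteEpsData` `D`, `(hcor : B16.Cor3With D.C γB em ep)`, tuned bare couplings within `]0, γ] ⊆ ]0, γB]` ending at
`g_K = g`, a run-index map `κ`, a measurable observable family `|F_K| ≤ B`, binder (α) `hα` EXACTLY as in
`T4StabilitySocket.lowEnvelope_of_cor3With`; and IN PLACE OF its (γ) `hfloor`: a measurable core set `S K` of the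
final-scale configurations of the run `κ K` with mass `≥ θ > 0` (`hmass`), on which (P1) `χ ≥ 1` (`hχ`) and (P2)
`A(U ·) ≤ a` (`hA`); the site budget `hsites` and ANY numerator-side envelope `0 ≤ nup ≤ Nup` as there.  Conclusion:
`LowEnvelope` with `nlow = e^{−(l₀B + e₋⁺·n₁)}·c₀`, `C = Nup·e^{l₀B + e₋⁺·n₁}/c₀`, `e₋⁺ = max (e₋(g)) 0`, and NOW
`c₀ = floorOf g a θ = e^{−a/g²}·θ` — the socket's shapes `nlowOf`/`constOf` VERBATIM, so every consumer of the socket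
(`globalDom_of_lowEnvelope`, `regeneration_of_lowEnvelope`, `exists_relWeightBound_of_lowEnvelopes`) applies unchanged. [folklore] -/
theorem lowEnvelope_of_cor3With_core (D : FiniteEpsData F G) (hsign : B16.SignConventions D.C)
    {γB γ g : ℝ} {em ep : ℝ → ℝ} {g₀ : ℕ → ℝ} (hcor : B16.Cor3With D.C γB em ep) (hγ : γ ≤ γB)
    (htuned : D.Tuned γ g g₀) (κ : ℕ → ℕ)
    {obs : (K : ℕ) → GaugeField (F.P K) 0 G → ℝ} {B l₀ : ℝ}
    (hobs : ∀ K, Measurable (obs K)) (hbd : ∀ K U, |obs K U| ≤ B)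
    {ι : Type*} {T : ℕ → Finset ι} {A : ℕ → ℝ → ι → ℝ} {K₀ : ℕ}
    (hα : ∀ K t, |t| ≤ l₀ → K₀ ≤ K →
      ∫ U, Real.exp (t * obs (κ K) U) * D.dens (κ K) (g₀ (κ K)) 0 U ∂fieldMeasure (F.P (κ K)) 0 G ≤
        ∑ τ ∈ T K, A K t τ)
    {S : (K : ℕ) → Set (GaugeField (F.P (κ K)) (κ K) G)} (hS : ∀ K, MeasurableSet (S K))
    {a θ n₁ : ℝ} (hθ : 0 < θ) (hmass : ∀ K, K₀ ≤ K → θ ≤ (fieldMeasure (F.P (κ K)) (κ K) G).real (S K))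
    (hχ : ∀ K, K₀ ≤ K → ∀ V ∈ S K,
      1 ≤ (D.C ⟨κ K, F.m, g₀ (κ K)⟩).χ (κ K) ((D.real.cfg (κ K) (g₀ (κ K)) (κ K)).symm V))
    (hA : ∀ K, K₀ ≤ K → ∀ V ∈ S K,
      (D.C ⟨κ K, F.m, g₀ (κ K)⟩).wilsonBG (κ K) ((D.real.cfg (κ K) (g₀ (κ K)) (κ K)).symm V) ≤ a)
    (hsites : ∀ K, K₀ ≤ K → ((D.C ⟨κ K, F.m, g₀ (κ K)⟩).numSites (κ K) : ℝ) ≤ n₁)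
    {nup : ℕ → ℝ → ℝ} {Nup : ℝ} (hnup : ∀ K t, |t| ≤ l₀ → K₀ ≤ K → 0 ≤ nup K t ∧ nup K t ≤ Nup) :
    LowEnvelope l₀ T A (nlowOf l₀ B (max (em g) 0) n₁ (floorOf g a θ)) nup
      (constOf l₀ B (max (em g) 0) n₁ (floorOf g a θ) Nup) K₀ where
  low K t ht hK := by
    have hB0 : 0 ≤ B := (abs_nonneg _).trans (hbd (κ K) 1)
    have hI : (D.C ⟨κ K, F.m, g₀ (κ K)⟩).flow.InInterval γB (κ K) := fun k hk =>
      ⟨((htuned (κ K)).1 k hk).1, ((htuned (κ K)).1 k hk).2.trans hγ⟩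
    have hgK : (D.C ⟨κ K, F.m, g₀ (κ K)⟩).flow.g (κ K) = g := (htuned (κ K)).2
    have hchain := dressed_lower_core D hsign hcor (κ K) (g₀ (κ K)) hI (hS K) (hχ K hK) (hA K hK)
      (hobs (κ K)) (hbd (κ K)) t
    rw [hgK] at hchain
    have hn0 : 0 ≤ ((D.C ⟨κ K, F.m, g₀ (κ K)⟩).numSites (κ K) : ℝ) := Nat.cast_nonneg _
    have h1 : |t| * B ≤ l₀ * B := mul_le_mul_of_nonneg_right ht hB0
    have h2 : em g * ((D.C ⟨κ K, F.m, g₀ (κ K)⟩).numSites (κ K) : ℝ) ≤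
        max (em g) 0 * ((D.C ⟨κ K, F.m, g₀ (κ K)⟩).numSites (κ K) : ℝ) :=
      mul_le_mul_of_nonneg_right (le_max_left _ _) hn0
    have h3 : max (em g) 0 * ((D.C ⟨κ K, F.m, g₀ (κ K)⟩).numSites (κ K) : ℝ) ≤ max (em g) 0 * n₁ :=
      mul_le_mul_of_nonneg_left (hsites K hK) (le_max_right _ _)
    calc nlowOf l₀ B (max (em g) 0) n₁ (floorOf g a θ) K t
        = Real.exp (-(l₀ * B + max (em g) 0 * n₁)) * (Real.exp (-(1 / g ^ 2 * a)) * θ) := rfl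
      _ = Real.exp (-(l₀ * B + max (em g) 0 * n₁) + -(1 / g ^ 2 * a)) * θ := by rw [Real.exp_add, mul_assoc]
      _ ≤ Real.exp (-(|t| * B) + -(1 / g ^ 2 * a +
              em g * ((D.C ⟨κ K, F.m, g₀ (κ K)⟩).numSites (κ K) : ℝ))) *
            (fieldMeasure (F.P (κ K)) (κ K) G).real (S K) :=
          mul_le_mul (Real.exp_le_exp.mpr (by linarith)) (hmass K hK) hθ.le (Real.exp_nonneg _)
      _ = Real.exp (-(|t| * B)) * (Real.exp (-(1 / g ^ 2 * a +
              em g * ((D.C ⟨κ K, F.m, g₀ (κ K)⟩).numSites (κ K) : ℝ))) *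
            (fieldMeasure (F.P (κ K)) (κ K) G).real (S K)) := by rw [Real.exp_add, mul_assoc]
      _ ≤ ∫ U, Real.exp (t * obs (κ K) U) * D.dens (κ K) (g₀ (κ K)) 0 U ∂fieldMeasure (F.P (κ K)) 0 G := hchain
      _ ≤ ∑ τ ∈ T K, A K t τ := hα K t ht hK
  nup_nonneg K t ht hK := (hnup K t ht hK).1
  ratio K t ht hK := by
    rw [constOf_mul_nlowOf (floorOf_pos hθ).ne']
    exact (hnup K t ht hK).2

/-- **THE (G2)/(G5) SOCKET WITH ITS FLOOR DISCHARGED — bond-ball form.**  The core sets are the bond balls `Π_b B` of ONE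
measurable one-bond set `B ⊆ G` of positive Haar mass `θ₁ = haar(B) > 0` (`hθ`), at the final scale of every run `κ K`;
their masses are ALL EQUAL to `θ₁^{unitBondCount F}` (§2, PROVED), so `hmass` disappears and the floor is
`c₀ = floorOf g a (θ₁^{unitBondCount F}) = e^{−a/g²} · θ₁^{4(2L^m)^4}`.  Remaining binders: (α) `hα`, (P1) `hχ`, (P2) `hA`,
`hsites`, the numerator envelope — and NOTHING named `c_low` / `hfloor`. [folklore] -/
theorem lowEnvelope_of_cor3With_ball (D : FiniteEpsData F G) (hsign : B16.SignConventions D.C)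
    {γB γ g : ℝ} {em ep : ℝ → ℝ} {g₀ : ℕ → ℝ} (hcor : B16.Cor3With D.C γB em ep) (hγ : γ ≤ γB)
    (htuned : D.Tuned γ g g₀) (κ : ℕ → ℕ)
    {obs : (K : ℕ) → GaugeField (F.P K) 0 G → ℝ} {B l₀ : ℝ}
    (hobs : ∀ K, Measurable (obs K)) (hbd : ∀ K U, |obs K U| ≤ B)
    {ι : Type*} {T : ℕ → Finset ι} {A : ℕ → ℝ → ι → ℝ} {K₀ : ℕ}
    (hα : ∀ K t, |t| ≤ l₀ → K₀ ≤ K →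
      ∫ U, Real.exp (t * obs (κ K) U) * D.dens (κ K) (g₀ (κ K)) 0 U ∂fieldMeasure (F.P (κ K)) 0 G ≤
        ∑ τ ∈ T K, A K t τ)
    {Bset : Set G} (hB : MeasurableSet Bset) (hθ : 0 < (HaarData.haar (G := G)).real Bset) {a n₁ : ℝ}
    (hχ : ∀ K, K₀ ≤ K → ∀ V : GaugeField (F.P (κ K)) (κ K) G, (∀ b, V b ∈ Bset) →
      1 ≤ (D.C ⟨κ K, F.m, g₀ (κ K)⟩).χ (κ K) ((D.real.cfg (κ K) (g₀ (κ K)) (κ K)).symm V))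
    (hA : ∀ K, K₀ ≤ K → ∀ V : GaugeField (F.P (κ K)) (κ K) G, (∀ b, V b ∈ Bset) →
      (D.C ⟨κ K, F.m, g₀ (κ K)⟩).wilsonBG (κ K) ((D.real.cfg (κ K) (g₀ (κ K)) (κ K)).symm V) ≤ a)
    (hsites : ∀ K, K₀ ≤ K → ((D.C ⟨κ K, F.m, g₀ (κ K)⟩).numSites (κ K) : ℝ) ≤ n₁)
    {nup : ℕ → ℝ → ℝ} {Nup : ℝ} (hnup : ∀ K t, |t| ≤ l₀ → K₀ ≤ K → 0 ≤ nup K t ∧ nup K t ≤ Nup) :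
    LowEnvelope l₀ T A
      (nlowOf l₀ B (max (em g) 0) n₁ (floorOf g a ((HaarData.haar (G := G)).real Bset ^ unitBondCount F))) nup
      (constOf l₀ B (max (em g) 0) n₁ (floorOf g a ((HaarData.haar (G := G)).real Bset ^ unitBondCount F)) Nup) K₀ :=
  lowEnvelope_of_cor3With_core D hsign hcor hγ htuned κ hobs hbd hα
    (S := fun K => bondBall (F.P (κ K)) (κ K) Bset) (fun _ => measurableSet_bondBall hB)
    (pow_pos hθ _) (fun K _ => (fieldMeasure_real_bondBall_top F (κ K) Bset).ge)
    (fun K hK V hV => hχ K hK V hV) (fun K hK V hV => hA K hK V hV) hsites hnup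

/-- **THE FLOORED SOCKET FROM THE PIN** `(hB : B16.EndStatementBPrinted D.C)`, in the quantifier order of the cell's
conditional targets (`T4ContinuumYM4Torus.ForSmallCouplings`), exactly as `T4StabilitySocket.lowEnvelope_of_endStatementBPrinted`
but with the (γ) floor `c₀` and its positivity REPLACED by: a measurable one-bond set `B` of positive Haar mass, a level
`a`, and the pointwise binders (P1) `χ_K ≥ 1` / (P2) `A(U_K ·) ≤ a` on its bond balls.  The `Thm1Printed` conjunct of
the pin is not used. [folklore] -/
theorem lowEnvelope_of_endStatementBPrinted_ball (D : FiniteEpsData F G) (hsign : B16.SignConventions D.C)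
    (hB : B16.EndStatementBPrinted D.C)
    (obs : (K : ℕ) → GaugeField (F.P K) 0 G → ℝ) (B l₀ : ℝ)
    (hobs : ∀ K, Measurable (obs K)) (hbd : ∀ K U, |obs K U| ≤ B) :
    ∃ γ₀ : ℝ, 0 < γ₀ ∧ ∀ γ g : ℝ, γ ≤ γ₀ → ∃ Em : ℝ, 0 ≤ Em ∧
      ∀ (g₀ : ℕ → ℝ), D.Tuned γ g g₀ → ∀ (κ : ℕ → ℕ) {ι : Type u} (T : ℕ → Finset ι) (A : ℕ → ℝ → ι → ℝ) (K₀ : ℕ),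
        (∀ K t, |t| ≤ l₀ → K₀ ≤ K →
          ∫ U, Real.exp (t * obs (κ K) U) * D.dens (κ K) (g₀ (κ K)) 0 U ∂fieldMeasure (F.P (κ K)) 0 G ≤
            ∑ τ ∈ T K, A K t τ) →
        ∀ (Bset : Set G), MeasurableSet Bset → 0 < (HaarData.haar (G := G)).real Bset →
        ∀ (a n₁ : ℝ),
          (∀ K, K₀ ≤ K → ∀ V : GaugeField (F.P (κ K)) (κ K) G, (∀ b, V b ∈ Bset) →
            1 ≤ (D.C ⟨κ K, F.m, g₀ (κ K)⟩).χ (κ K) ((D.real.cfg (κ K) (g₀ (κ K)) (κ K)).symm V)) →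
          (∀ K, K₀ ≤ K → ∀ V : GaugeField (F.P (κ K)) (κ K) G, (∀ b, V b ∈ Bset) →
            (D.C ⟨κ K, F.m, g₀ (κ K)⟩).wilsonBG (κ K) ((D.real.cfg (κ K) (g₀ (κ K)) (κ K)).symm V) ≤ a) →
          (∀ K, K₀ ≤ K → ((D.C ⟨κ K, F.m, g₀ (κ K)⟩).numSites (κ K) : ℝ) ≤ n₁) →
        ∀ (nup : ℕ → ℝ → ℝ) (Nup : ℝ), (∀ K t, |t| ≤ l₀ → K₀ ≤ K → 0 ≤ nup K t ∧ nup K t ≤ Nup) →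
          LowEnvelope l₀ T A
            (nlowOf l₀ B Em n₁ (floorOf g a ((HaarData.haar (G := G)).real Bset ^ unitBondCount F))) nup
            (constOf l₀ B Em n₁ (floorOf g a ((HaarData.haar (G := G)).real Bset ^ unitBondCount F)) Nup) K₀ := by
  obtain ⟨γB, hγB, em, ep, hcor⟩ := hB.2
  refine ⟨γB, hγB, fun γ g hγ => ⟨max (em g) 0, le_max_right _ _, ?_⟩⟩
  intro g₀ htuned κ ι T A K₀ hα Bset hBm hθ a n₁ hχ hA hsites nup Nup hnup
  exact lowEnvelope_of_cor3With_ball D hsign hcor hγ htuned κ hobs hbd hα hBm hθ hχ hA hsites hnup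

/-- **… AND INTO (GD)** (one run, bond-ball form): with the numerator owners' fields the pin yields `GlobalDom` itself,
its denominator fields carrying the EXPLICIT floor. [folklore] -/
theorem globalDom_of_cor3With_ball (D : FiniteEpsData F G) (hsign : B16.SignConventions D.C)
    {γB γ g : ℝ} {em ep : ℝ → ℝ} {g₀ : ℕ → ℝ} (hcor : B16.Cor3With D.C γB em ep) (hγ : γ ≤ γB)
    (htuned : D.Tuned γ g g₀) (κ : ℕ → ℕ)
    {obs : (K : ℕ) → GaugeField (F.P K) 0 G → ℝ} {B l₀ : ℝ}
    (hobs : ∀ K, Measurable (obs K)) (hbd : ∀ K U, |obs K U| ≤ B)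
    {ι : Type*} {T : ℕ → Finset ι} {A : ℕ → ℝ → ι → ℝ} {Bad : ℕ → ℝ → Finset ι} {Fh : ℕ → ι → ℝ} {K₀ : ℕ}
    (hα : ∀ K t, |t| ≤ l₀ → K₀ ≤ K →
      ∫ U, Real.exp (t * obs (κ K) U) * D.dens (κ K) (g₀ (κ K)) 0 U ∂fieldMeasure (F.P (κ K)) 0 G ≤
        ∑ τ ∈ T K, A K t τ)
    {Bset : Set G} (hB : MeasurableSet Bset) (hθ : 0 < (HaarData.haar (G := G)).real Bset) {a n₁ : ℝ}
    (hχ : ∀ K, K₀ ≤ K → ∀ V : GaugeField (F.P (κ K)) (κ K) G, (∀ b, V b ∈ Bset) →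
      1 ≤ (D.C ⟨κ K, F.m, g₀ (κ K)⟩).χ (κ K) ((D.real.cfg (κ K) (g₀ (κ K)) (κ K)).symm V))
    (hA : ∀ K, K₀ ≤ K → ∀ V : GaugeField (F.P (κ K)) (κ K) G, (∀ b, V b ∈ Bset) →
      (D.C ⟨κ K, F.m, g₀ (κ K)⟩).wilsonBG (κ K) ((D.real.cfg (κ K) (g₀ (κ K)) (κ K)).symm V) ≤ a)
    (hsites : ∀ K, K₀ ≤ K → ((D.C ⟨κ K, F.m, g₀ (κ K)⟩).numSites (κ K) : ℝ) ≤ n₁)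
    {nup : ℕ → ℝ → ℝ} {Nup : ℝ} (hnup : ∀ K t, |t| ≤ l₀ → K₀ ≤ K → 0 ≤ nup K t ∧ nup K t ≤ Nup)
    (bad_subset : ∀ K t, |t| ≤ l₀ → K₀ ≤ K → Bad K t ⊆ T K)
    (up : ∀ K t, |t| ≤ l₀ → K₀ ≤ K → ∀ τ ∈ Bad K t, A K t τ ≤ Fh K τ * nup K t)
    (F_nonneg : ∀ K t, |t| ≤ l₀ → K₀ ≤ K → ∀ τ ∈ Bad K t, 0 ≤ Fh K τ) :
    GlobalDom l₀ T A Bad Fh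
      (nlowOf l₀ B (max (em g) 0) n₁ (floorOf g a ((HaarData.haar (G := G)).real Bset ^ unitBondCount F))) nup
      (constOf l₀ B (max (em g) 0) n₁ (floorOf g a ((HaarData.haar (G := G)).real Bset ^ unitBondCount F)) Nup) K₀ :=
  globalDom_of_lowEnvelope
    (lowEnvelope_of_cor3With_ball D hsign hcor hγ htuned κ hobs hbd hα hB hθ hχ hA hsites hnup)
    bad_subset up F_nonneg

end Floor

/-! ## §5 The two pointwise binders (P1)/(P2) from binders of verbatim printed shape — (2.17), (5), Thm 1 (8) — and
the `K`-uniform fine-plaquette budget `#plaquettes(T_η) · η⁴ = 6 · (2L^m)^4` (PROVED) -/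

section Reading

variable {F : T4Family} {G : Type*} [GaugeGroup G] [MeasurableSpace G] [HaarData G]

omit [MeasurableSpace G] [HaarData G] in
/-- One fine plaquette: `|h − 1| < b` and the group-model inequality `1 − Re tr h ≤ c_G |h − 1|²` give
`1 − Re tr h ≤ c_G · b²`. [folklore] -/
theorem one_sub_reTr_le_of_dist1_lt {cG b : ℝ} (hG : ∀ h : G, 1 - reTr h ≤ cG * dist1 h ^ 2) (hcG : 0 ≤ cG)
    {h : G} (hb : dist1 h < b) : 1 - reTr h ≤ cG * b ^ 2 :=
  (hG h).trans (mul_le_mul_of_nonneg_left (pow_le_pow_left₀ (GaugeGroup.dist1_nonneg h) hb.le 2) hcG)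

/-- **(P1) AND (P2) FROM THE PRINTED EQUATIONS, one run, one `K`.**  Data: a finite type `Fine` (the plaquettes of
`T_η`, `η = L^{−K}`) and `plaq V p` = the plaquette variable `U_K(V)(∂p)` of the minimal configuration (both the
instantiating seat's dictionary).  Binders, each the TYPE of one printed line and none asserted here:
`hchi` — [Balaban1988Convergent] (2.17) p. 257 «χ_k(Ω_k) = Π_{□⊂Ω_k} χ({sup_{p⊂□~}|U_{k,□}(V_k,∂p) − 1| < ε_kη²})» read at
`k = K`, `Ω_K = T_η`, for the function `χ_K = χ_K(T_η)` of (2.50) (print has the localized minimisers `U_{k,□}` of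
(2.16) where this binder has ONE plaquette family `plaq`: it is stated for whichever family the seat reads (2.17) with);
`hwil` — [Balaban1985Variational] (5) p. 278 «A(U) = A^η(U) = Σ_{p⊂Ω₀} η^{d−4}[1 − Re tr U(∂p)], η = L^{−k}» in `d = 4`
(`η^{d−4} = 1`) for `U = U_K(V)` — the `A^η(U_k(V))` of [Balaban1987RG1] (0.22) p. 256, tree field `wilsonBG`;
`hreg` — [Balaban1985Variational] Thm 1 p. 279 «There exist positive constants a₀, a₁, B₃, B₄(β₀), M(ε₁), B₃a₁ ≤ a₀, such
that for an arbitrary configuration V satisfying (7) with ε₁ ≤ a₁ there exists a minimal orbit in the space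
𝔘_k({Ω_j}, B₃ε₁) ∩ 𝔅_k(𝔅_k, V). (8)», «The constants a₀, a₁, B₃, depend on d and L only», with the space (2) p. 278
«|U(∂p) − 1| = |(∂U)(p) − 1| < ε₀L^{−2j} = ε₀η²(L^jη)^{−2} for p∈Ω_j, j = 0, 1, …, k» (at `j = k`, `ε₀ = B₃ε₁`:
`< B₃ε₁η²`), ON the core set `S` — for the bond ball of radius `τ` the hypothesis (7) p. 278 «|(∂V)(p′) − 1| < ε₁ for
p′∈𝔅_k» holds with `ε₁ = 4τ` by `dist1_mul_le`/`dist1_inv`;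
`hε` — the threshold order `B₃ε₁ ≤ ε_K`, `ε_K = g_K p₀(g_K)` ([Balaban1988Convergent] p. 246 «in the first step we take
ε₀ = g₀p₀(g₀), p₀(g₀) = A₀(log g₀⁻²)^{p₀}», «ε₁ = g₁p₀(g₁)»; tree `epsK`) — under `FiniteEpsData.Tuned γ g g₀`, `g_K = g`
and `ε_K = g·p₀(g)` is ONE number for every `K`;
`hG`, `hcG` — the group-model inequality `1 − Re tr h ≤ c_G|h − 1|²`, `c_G ≥ 0` (normalised trace; a binder over the
abstract `GaugeGroup`);
`hcount` — the fine-plaquette budget `#Fine · η⁴ ≤ n₄` (in the model `#plaquettes(T_η) · η⁴ = 6·(2L^m)^4` EXACTLY for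
every `K`: `card_plaq_fine_mul_eta_pow` below).
Conclusions: (P1) `χ_K ≥ 1` on `S` and (P2) `A(U_K ·) ≤ c_G (B₃ε₁)² n₄` on `S` — the level `a = c_G(B₃ε₁)²n₄` is EXPLICIT
and `K`-UNIFORM (the `η⁴` of the `#Fine` plaquette deviations `(B₃ε₁η²)²` cancels the `η^{−4}` of their number).  These
are exactly the binders `hχ`, `hA` of §3–§4. [cite: Balaban1985Variational, Thm 1 p.279] -/
theorem pointwise_of_reading (D : FiniteEpsData F G) (K : ℕ) (g₀ : ℝ)
    {Fine : Type*} [Fintype Fine] (plaq : GaugeField (F.P K) K G → Fine → G) {εK η B₃ ε₁ cG n4 : ℝ}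
    (hchi : ∀ V, (∀ p, dist1 (plaq V p) < εK * η ^ 2) →
      (D.C ⟨K, F.m, g₀⟩).χ K ((D.real.cfg K g₀ K).symm V) = 1)
    (hwil : ∀ V, (D.C ⟨K, F.m, g₀⟩).wilsonBG K ((D.real.cfg K g₀ K).symm V) = ∑ p, (1 - reTr (plaq V p)))
    (hG : ∀ h : G, 1 - reTr h ≤ cG * dist1 h ^ 2) (hcG : 0 ≤ cG)
    (hcount : (Fintype.card Fine : ℝ) * η ^ 4 ≤ n4)
    {S : Set (GaugeField (F.P K) K G)} (hreg : ∀ V ∈ S, ∀ p, dist1 (plaq V p) < B₃ * ε₁ * η ^ 2)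
    (hε : B₃ * ε₁ ≤ εK) :
    (∀ V ∈ S, 1 ≤ (D.C ⟨K, F.m, g₀⟩).χ K ((D.real.cfg K g₀ K).symm V)) ∧
      (∀ V ∈ S, (D.C ⟨K, F.m, g₀⟩).wilsonBG K ((D.real.cfg K g₀ K).symm V) ≤ cG * (B₃ * ε₁) ^ 2 * n4) := by
  refine ⟨fun V hV => ?_, fun V hV => ?_⟩
  · refine le_of_eq (hchi V fun p => ?_).symm
    exact (hreg V hV p).trans_le (mul_le_mul_of_nonneg_right hε (sq_nonneg η))
  · rw [hwil V]
    calc ∑ p, (1 - reTr (plaq V p)) ≤ ∑ _p : Fine, cG * (B₃ * ε₁ * η ^ 2) ^ 2 :=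
          Finset.sum_le_sum fun p _ => one_sub_reTr_le_of_dist1_lt hG hcG (hreg V hV p)
      _ = cG * (B₃ * ε₁) ^ 2 * ((Fintype.card Fine : ℝ) * η ^ 4) := by
          rw [Finset.sum_const, Finset.card_univ, nsmul_eq_mul]
          ring
      _ ≤ cG * (B₃ * ε₁) ^ 2 * n4 := mul_le_mul_of_nonneg_left hcount (by positivity)

omit [GaugeGroup G] [MeasurableSpace G] [HaarData G] in
/-- THE PLAQUETTE COUNT of `T^{(j)}`: a positively oriented plaquette is (site, ordered pair of directions `μ < ν`). [folklore] -/
theorem card_plaq (P : Params) (j : ℕ) :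
    Fintype.card (Plaq P j) = P.sitesPerDir j ^ P.d * Fintype.card {x : Fin P.d × Fin P.d // x.1 < x.2} := by
  rw [Fintype.card_congr (⟨fun p => (p.src, ⟨(p.μ, p.ν), p.hμν⟩), fun t => ⟨t.1, t.2.1.1, t.2.1.2, t.2.2⟩,
      fun _ => rfl, fun _ => rfl⟩ : Plaq P j ≃ Site P j × {x : Fin P.d × Fin P.d // x.1 < x.2}),
    Fintype.card_prod, Site.card_site]

omit [GaugeGroup G] [MeasurableSpace G] [HaarData G] in
/-- THE FINE PLAQUETTE COUNT of the `K`-th run: `#plaquettes(T_η) = #plaquettes(T^{(0)} of F.P K) = (2L^{m+K})^4 · 6`. [folklore] -/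
theorem card_plaq_fine (F : T4Family) (K : ℕ) : Fintype.card (Plaq (F.P K) 0) = (2 * F.L ^ (F.m + K)) ^ 4 * 6 := by
  rw [Fintype.card_congr (⟨fun p => (p.src, ⟨(p.μ, p.ν), p.hμν⟩), fun t => ⟨t.1, t.2.1.1, t.2.1.2, t.2.2⟩,
      fun _ => rfl, fun _ => rfl⟩ : Plaq (F.P K) 0 ≃ Site (F.P K) 0 × {x : Fin 4 × Fin 4 // x.1 < x.2}),
    Fintype.card_prod, Site.card_site, (by decide : Fintype.card {x : Fin 4 × Fin 4 // x.1 < x.2} = 6)]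
  simp [Params.sitesPerDir]

omit [GaugeGroup G] [MeasurableSpace G] [HaarData G] in
/-- **THE `K`-UNIFORM FINE-PLAQUETTE BUDGET**: `#plaquettes(T_η) · η⁴ = 6 · (2L^m)^4` with `η = L^{−K}` (tree
`Params.eta`) — ONE number for every `K` (so `n₄ := 6(2L^m)^4` discharges `hcount` of `pointwise_of_reading` with
EQUALITY, uniformly in `K`). [folklore] -/
theorem card_plaq_fine_mul_eta_pow (F : T4Family) (K : ℕ) :
    (Fintype.card (Plaq (F.P K) 0) : ℝ) * ((F.P K).eta K) ^ 4 = 6 * (2 * (F.L : ℝ) ^ F.m) ^ 4 := by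
  rw [card_plaq_fine]
  have hL : (F.L : ℝ) ≠ 0 := by
    have := F.hL.2
    exact_mod_cast (show F.L ≠ 0 by omega)
  have hK : (F.L : ℝ) ^ (F.m + K) * ((F.L : ℝ)⁻¹) ^ K = (F.L : ℝ) ^ F.m := by
    rw [pow_add, mul_assoc, ← mul_pow, mul_inv_cancel₀ hL, one_pow, mul_one]
  simp only [Params.eta, T4Family.P_L]
  push_cast
  calc ((2 * (F.L : ℝ) ^ (F.m + K)) ^ 4 * 6) * (((F.L : ℝ)⁻¹) ^ K) ^ 4
      = 6 * (2 * ((F.L : ℝ) ^ (F.m + K) * ((F.L : ℝ)⁻¹) ^ K)) ^ 4 := by ring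
    _ = 6 * (2 * (F.L : ℝ) ^ F.m) ^ 4 := by rw [hK]

variable [RegularGaugeGroup G]

/-- **THE (G2)/(G5) SOCKET, FLOOR DISCHARGED DOWN TO THE PRINTED EQUATIONS** (bond-ball form ∘ `pointwise_of_reading`):
the binders (P1)/(P2) of `lowEnvelope_of_cor3With_ball` are replaced, for every run `κ K`, `K ≥ K₀`, by the seat's
plaquette dictionary `plaq K` on a finite type `Fine K` and the printed-shape binders `hchi` (2.17), `hwil` (5),
`hreg` (Thm 1 (8) on the bond ball of `B`), `hε` (`B₃ε₁ ≤ ε_K`), `hG`/`hcG` (group model), `hcount` (`#Fine·η⁴ ≤ n₄`);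
the floor is then `c₀ = floorOf g (c_G(B₃ε₁)²n₄) (haar(B)^{unitBondCount F}) = exp[−c_G(B₃ε₁)²n₄/g²] · haar(B)^{4(2L^m)^4}`,
EVERY symbol in it a datum of the binders, none a named constant of the node. [folklore] -/
theorem lowEnvelope_of_cor3With_reading (D : FiniteEpsData F G) (hsign : B16.SignConventions D.C)
    {γB γ g : ℝ} {em ep : ℝ → ℝ} {g₀ : ℕ → ℝ} (hcor : B16.Cor3With D.C γB em ep) (hγ : γ ≤ γB)
    (htuned : D.Tuned γ g g₀) (κ : ℕ → ℕ)
    {obs : (K : ℕ) → GaugeField (F.P K) 0 G → ℝ} {B l₀ : ℝ}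
    (hobs : ∀ K, Measurable (obs K)) (hbd : ∀ K U, |obs K U| ≤ B)
    {ι : Type*} {T : ℕ → Finset ι} {A : ℕ → ℝ → ι → ℝ} {K₀ : ℕ}
    (hα : ∀ K t, |t| ≤ l₀ → K₀ ≤ K →
      ∫ U, Real.exp (t * obs (κ K) U) * D.dens (κ K) (g₀ (κ K)) 0 U ∂fieldMeasure (F.P (κ K)) 0 G ≤
        ∑ τ ∈ T K, A K t τ)
    {Bset : Set G} (hB : MeasurableSet Bset) (hθ : 0 < (HaarData.haar (G := G)).real Bset)
    {Fine : ℕ → Type*} [∀ K, Fintype (Fine K)] (plaq : (K : ℕ) → GaugeField (F.P (κ K)) (κ K) G → Fine K → G)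
    {εK η : ℕ → ℝ} {B₃ ε₁ cG n4 n₁ : ℝ}
    (hchi : ∀ K, K₀ ≤ K → ∀ V, (∀ p, dist1 (plaq K V p) < εK K * η K ^ 2) →
      (D.C ⟨κ K, F.m, g₀ (κ K)⟩).χ (κ K) ((D.real.cfg (κ K) (g₀ (κ K)) (κ K)).symm V) = 1)
    (hwil : ∀ K, K₀ ≤ K → ∀ V, (D.C ⟨κ K, F.m, g₀ (κ K)⟩).wilsonBG (κ K) ((D.real.cfg (κ K) (g₀ (κ K)) (κ K)).symm V) =
      ∑ p, (1 - reTr (plaq K V p)))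
    (hG : ∀ h : G, 1 - reTr h ≤ cG * dist1 h ^ 2) (hcG : 0 ≤ cG)
    (hcount : ∀ K, K₀ ≤ K → (Fintype.card (Fine K) : ℝ) * η K ^ 4 ≤ n4)
    (hreg : ∀ K, K₀ ≤ K → ∀ V : GaugeField (F.P (κ K)) (κ K) G, (∀ b, V b ∈ Bset) →
      ∀ p, dist1 (plaq K V p) < B₃ * ε₁ * η K ^ 2)
    (hε : ∀ K, K₀ ≤ K → B₃ * ε₁ ≤ εK K)
    (hsites : ∀ K, K₀ ≤ K → ((D.C ⟨κ K, F.m, g₀ (κ K)⟩).numSites (κ K) : ℝ) ≤ n₁)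
    {nup : ℕ → ℝ → ℝ} {Nup : ℝ} (hnup : ∀ K t, |t| ≤ l₀ → K₀ ≤ K → 0 ≤ nup K t ∧ nup K t ≤ Nup) :
    LowEnvelope l₀ T A
      (nlowOf l₀ B (max (em g) 0) n₁
        (floorOf g (cG * (B₃ * ε₁) ^ 2 * n4) ((HaarData.haar (G := G)).real Bset ^ unitBondCount F))) nup
      (constOf l₀ B (max (em g) 0) n₁
        (floorOf g (cG * (B₃ * ε₁) ^ 2 * n4) ((HaarData.haar (G := G)).real Bset ^ unitBondCount F)) Nup) K₀ :=
  lowEnvelope_of_cor3With_ball D hsign hcor hγ htuned κ hobs hbd hα hB hθ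
    (fun K hK => (pointwise_of_reading D (κ K) (g₀ (κ K)) (plaq K) (hchi K hK) (hwil K hK) hG hcG (hcount K hK)
      (S := bondBall (F.P (κ K)) (κ K) Bset) (fun V hV => hreg K hK V hV) (hε K hK)).1)
    (fun K hK => (pointwise_of_reading D (κ K) (g₀ (κ K)) (plaq K) (hchi K hK) (hwil K hK) hG hcG (hcount K hK)
      (S := bondBall (F.P (κ K)) (κ K) Bset) (fun V hV => hreg K hK V hV) (hε K hK)).2)
    hsites hnup

end Reading

/-! ## §6 (v1.1) TWO PLAQUETTE FAMILIES — (P1) from the LOCALISED minimisers' plaquette variables ((2.16)/(2.17)),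
(P2) from the GLOBAL minimiser's ((5), Thm 1 (8)); item O-R13 of RULING R-GD-2 -/

section TwoFamilies

variable {F : T4Family} {G : Type*} [GaugeGroup G] [MeasurableSpace G] [HaarData G]

/-- **(P1) ALONE, FROM THE LOCALISED FAMILY.**  Data: any type `FineLoc` (in print: the pairs `(□, p)`, `□` a cube of
the `LM₂R_K`-partition of `T_η` of (2.16)/(2.17) p. 257 — NOT a unit-lattice cube (v1.2 correction of v1.1's gloss,
XREAD t4-ref3-g27 D1) — and `p ⊂ □~`) and `plaqLoc V q` = the plaquette variable `U_{K,□}(V, ∂p)` of the LOCALISED minimal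
configuration of [Balaban1988Convergent] (2.16) p. 257 (the instantiating seat's dictionary; NO finiteness or count of
`FineLoc` is needed — print's family is finite, and for a finite family the binder's `∀ q, … < ε_Kη²` is print's
`sup < ε_Kη²`, pv06-g22 XREAD I-2).  Binders, none asserted: `hchi` — (2.17) p. 257 «χ_k(Ω_k) = Π_{□⊂Ω_k} χ({sup_{p⊂□~}|U_{k,□}(V_k,∂p)
− 1| < ε_kη²})» at `k = K`, `Ω_K = T_η`, now on the family print builds it from; `hregLoc` — regularity of Thm 1 (8)-TYPE
(«𝔘_k({Ω_j}, B₃ε₁)», (2) p. 278 at `j = k`: `< B₃ε₁η²`) for the LOCALISED minimisers on the core set `S` (each `U_{K,□}`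
is a determining-set minimal configuration, (2.13) p. 257; the print sentence giving (8) for it is to be LOCATED by the
dictionary seat or booked [R] — R-GD-2 P-6; the U5 referee's pointer, pv06-g22 XREAD I-3: Thm 1 (8) itself at
`𝔅 := 𝐁_K(□^{~4})`, `V′ := M˙(Q_K^{s*}V_K)` ((2.13)/(2.16), (1.3)), conditional on (7) for `V′`, whose check on the bond
ball is the seat's one located step [R]); `hε` — `B₃ε₁ ≤ ε_K`.  Conclusion (P1): `χ_K ≥ 1` on `S`.
[cite: Balaban1988Convergent, (2.17) p.257] -/
theorem p1_of_reading (D : FiniteEpsData F G) (K : ℕ) (g₀ : ℝ)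
    {FineLoc : Type*} (plaqLoc : GaugeField (F.P K) K G → FineLoc → G) {εK η B₃ ε₁ : ℝ}
    (hchi : ∀ V, (∀ q, dist1 (plaqLoc V q) < εK * η ^ 2) →
      (D.C ⟨K, F.m, g₀⟩).χ K ((D.real.cfg K g₀ K).symm V) = 1)
    {S : Set (GaugeField (F.P K) K G)} (hregLoc : ∀ V ∈ S, ∀ q, dist1 (plaqLoc V q) < B₃ * ε₁ * η ^ 2)
    (hε : B₃ * ε₁ ≤ εK) :
    ∀ V ∈ S, 1 ≤ (D.C ⟨K, F.m, g₀⟩).χ K ((D.real.cfg K g₀ K).symm V) := fun V hV =>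
  le_of_eq (hchi V fun q => (hregLoc V hV q).trans_le (mul_le_mul_of_nonneg_right hε (sq_nonneg η))).symm

/-- **(P2) ALONE, FROM THE GLOBAL FAMILY.**  Data: a finite type `Fine` (the plaquettes of `T_η`) and `plaq V p` =
`U_K(V)(∂p)` for the GLOBAL minimiser `U_K` of [Balaban1985Variational] Thm 1 / (2.50).  Binders, none asserted: `hwil` —
(5) p. 278 in `d = 4`; `hG`/`hcG` — group model; `hcount` — `#Fine·η⁴ ≤ n₄`; `hreg` — Thm 1 (8) with (2) at `j = k` on
the core set `S`.  Conclusion (P2): `A(U_K ·) ≤ c_G(B₃ε₁)²n₄` on `S`. [cite: Balaban1985Variational, Thm 1 p.279] -/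
theorem p2_of_reading (D : FiniteEpsData F G) (K : ℕ) (g₀ : ℝ)
    {Fine : Type*} [Fintype Fine] (plaq : GaugeField (F.P K) K G → Fine → G) {η B₃ ε₁ cG n4 : ℝ}
    (hwil : ∀ V, (D.C ⟨K, F.m, g₀⟩).wilsonBG K ((D.real.cfg K g₀ K).symm V) = ∑ p, (1 - reTr (plaq V p)))
    (hG : ∀ h : G, 1 - reTr h ≤ cG * dist1 h ^ 2) (hcG : 0 ≤ cG)
    (hcount : (Fintype.card Fine : ℝ) * η ^ 4 ≤ n4)
    {S : Set (GaugeField (F.P K) K G)} (hreg : ∀ V ∈ S, ∀ p, dist1 (plaq V p) < B₃ * ε₁ * η ^ 2) :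
    ∀ V ∈ S, (D.C ⟨K, F.m, g₀⟩).wilsonBG K ((D.real.cfg K g₀ K).symm V) ≤ cG * (B₃ * ε₁) ^ 2 * n4 := by
  intro V hV
  rw [hwil V]
  calc ∑ p, (1 - reTr (plaq V p)) ≤ ∑ _p : Fine, cG * (B₃ * ε₁ * η ^ 2) ^ 2 :=
        Finset.sum_le_sum fun p _ => one_sub_reTr_le_of_dist1_lt hG hcG (hreg V hV p)
    _ = cG * (B₃ * ε₁) ^ 2 * ((Fintype.card Fine : ℝ) * η ^ 4) := by
        rw [Finset.sum_const, Finset.card_univ, nsmul_eq_mul]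
        ring
    _ ≤ cG * (B₃ * ε₁) ^ 2 * n4 := mul_le_mul_of_nonneg_left hcount (by positivity)

/-- **(P1) AND (P2) WITH TWO PLAQUETTE FAMILIES** — `pointwise_of_reading` with `hchi`/`hregLoc` on the localised family
`plaqLoc` and `hwil`/`hreg`/`hG`/`hcount` on the global family `plaq`; conclusions and the level `a = c_G(B₃ε₁)²n₄`
IDENTICAL to `pointwise_of_reading`. [cite: Balaban1985Variational, Thm 1 p.279] -/
theorem pointwise_of_reading₂ (D : FiniteEpsData F G) (K : ℕ) (g₀ : ℝ)
    {FineLoc : Type*} (plaqLoc : GaugeField (F.P K) K G → FineLoc → G)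
    {Fine : Type*} [Fintype Fine] (plaq : GaugeField (F.P K) K G → Fine → G) {εK η B₃ ε₁ cG n4 : ℝ}
    (hchi : ∀ V, (∀ q, dist1 (plaqLoc V q) < εK * η ^ 2) →
      (D.C ⟨K, F.m, g₀⟩).χ K ((D.real.cfg K g₀ K).symm V) = 1)
    (hwil : ∀ V, (D.C ⟨K, F.m, g₀⟩).wilsonBG K ((D.real.cfg K g₀ K).symm V) = ∑ p, (1 - reTr (plaq V p)))
    (hG : ∀ h : G, 1 - reTr h ≤ cG * dist1 h ^ 2) (hcG : 0 ≤ cG)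
    (hcount : (Fintype.card Fine : ℝ) * η ^ 4 ≤ n4)
    {S : Set (GaugeField (F.P K) K G)} (hregLoc : ∀ V ∈ S, ∀ q, dist1 (plaqLoc V q) < B₃ * ε₁ * η ^ 2)
    (hreg : ∀ V ∈ S, ∀ p, dist1 (plaq V p) < B₃ * ε₁ * η ^ 2) (hε : B₃ * ε₁ ≤ εK) :
    (∀ V ∈ S, 1 ≤ (D.C ⟨K, F.m, g₀⟩).χ K ((D.real.cfg K g₀ K).symm V)) ∧
      (∀ V ∈ S, (D.C ⟨K, F.m, g₀⟩).wilsonBG K ((D.real.cfg K g₀ K).symm V) ≤ cG * (B₃ * ε₁) ^ 2 * n4) :=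
  ⟨p1_of_reading D K g₀ plaqLoc hchi hregLoc hε, p2_of_reading D K g₀ plaq hwil hG hcG hcount hreg⟩

variable [RegularGaugeGroup G]

/-- **THE (G2)/(G5) SOCKET, FLOOR DISCHARGED DOWN TO THE PRINTED EQUATIONS, TWO PLAQUETTE FAMILIES** (bond-ball form ∘
`p1_of_reading` ∘ `p2_of_reading`): as `lowEnvelope_of_cor3With_reading`, with `hchi` read on a localised family
`plaqLoc K` [(2.16)/(2.17)] together with its bond-ball regularity `hregLoc`, and `hwil`/`hreg`/`hG`/`hcount` on the global
family `plaq K` [(5), Thm 1 (8)].  SAME floor `c₀ = floorOf g (c_G(B₃ε₁)²n₄) (haar(B)^{unitBondCount F})`. [folklore] -/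
theorem lowEnvelope_of_cor3With_reading₂ (D : FiniteEpsData F G) (hsign : B16.SignConventions D.C)
    {γB γ g : ℝ} {em ep : ℝ → ℝ} {g₀ : ℕ → ℝ} (hcor : B16.Cor3With D.C γB em ep) (hγ : γ ≤ γB)
    (htuned : D.Tuned γ g g₀) (κ : ℕ → ℕ)
    {obs : (K : ℕ) → GaugeField (F.P K) 0 G → ℝ} {B l₀ : ℝ}
    (hobs : ∀ K, Measurable (obs K)) (hbd : ∀ K U, |obs K U| ≤ B)
    {ι : Type*} {T : ℕ → Finset ι} {A : ℕ → ℝ → ι → ℝ} {K₀ : ℕ}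
    (hα : ∀ K t, |t| ≤ l₀ → K₀ ≤ K →
      ∫ U, Real.exp (t * obs (κ K) U) * D.dens (κ K) (g₀ (κ K)) 0 U ∂fieldMeasure (F.P (κ K)) 0 G ≤
        ∑ τ ∈ T K, A K t τ)
    {Bset : Set G} (hB : MeasurableSet Bset) (hθ : 0 < (HaarData.haar (G := G)).real Bset)
    {FineLoc : ℕ → Type*} (plaqLoc : (K : ℕ) → GaugeField (F.P (κ K)) (κ K) G → FineLoc K → G)
    {Fine : ℕ → Type*} [∀ K, Fintype (Fine K)] (plaq : (K : ℕ) → GaugeField (F.P (κ K)) (κ K) G → Fine K → G)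
    {εK η : ℕ → ℝ} {B₃ ε₁ cG n4 n₁ : ℝ}
    (hchi : ∀ K, K₀ ≤ K → ∀ V, (∀ q, dist1 (plaqLoc K V q) < εK K * η K ^ 2) →
      (D.C ⟨κ K, F.m, g₀ (κ K)⟩).χ (κ K) ((D.real.cfg (κ K) (g₀ (κ K)) (κ K)).symm V) = 1)
    (hwil : ∀ K, K₀ ≤ K → ∀ V, (D.C ⟨κ K, F.m, g₀ (κ K)⟩).wilsonBG (κ K) ((D.real.cfg (κ K) (g₀ (κ K)) (κ K)).symm V) =
      ∑ p, (1 - reTr (plaq K V p)))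
    (hG : ∀ h : G, 1 - reTr h ≤ cG * dist1 h ^ 2) (hcG : 0 ≤ cG)
    (hcount : ∀ K, K₀ ≤ K → (Fintype.card (Fine K) : ℝ) * η K ^ 4 ≤ n4)
    (hregLoc : ∀ K, K₀ ≤ K → ∀ V : GaugeField (F.P (κ K)) (κ K) G, (∀ b, V b ∈ Bset) →
      ∀ q, dist1 (plaqLoc K V q) < B₃ * ε₁ * η K ^ 2)
    (hreg : ∀ K, K₀ ≤ K → ∀ V : GaugeField (F.P (κ K)) (κ K) G, (∀ b, V b ∈ Bset) →
      ∀ p, dist1 (plaq K V p) < B₃ * ε₁ * η K ^ 2)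
    (hε : ∀ K, K₀ ≤ K → B₃ * ε₁ ≤ εK K)
    (hsites : ∀ K, K₀ ≤ K → ((D.C ⟨κ K, F.m, g₀ (κ K)⟩).numSites (κ K) : ℝ) ≤ n₁)
    {nup : ℕ → ℝ → ℝ} {Nup : ℝ} (hnup : ∀ K t, |t| ≤ l₀ → K₀ ≤ K → 0 ≤ nup K t ∧ nup K t ≤ Nup) :
    LowEnvelope l₀ T A
      (nlowOf l₀ B (max (em g) 0) n₁
        (floorOf g (cG * (B₃ * ε₁) ^ 2 * n4) ((HaarData.haar (G := G)).real Bset ^ unitBondCount F))) nup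
      (constOf l₀ B (max (em g) 0) n₁
        (floorOf g (cG * (B₃ * ε₁) ^ 2 * n4) ((HaarData.haar (G := G)).real Bset ^ unitBondCount F)) Nup) K₀ :=
  lowEnvelope_of_cor3With_ball D hsign hcor hγ htuned κ hobs hbd hα hB hθ
    (fun K hK => p1_of_reading D (κ K) (g₀ (κ K)) (plaqLoc K) (hchi K hK) (S := bondBall (F.P (κ K)) (κ K) Bset)
      (fun V hV => hregLoc K hK V hV) (hε K hK))
    (fun K hK => p2_of_reading D (κ K) (g₀ (κ K)) (plaq K) (hwil K hK) hG hcG (hcount K hK)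
      (S := bondBall (F.P (κ K)) (κ K) Bset) (fun V hV => hreg K hK V hV))
    hsites hnup

/-- `lowEnvelope_of_cor3With_reading` IS the one-family special case `plaqLoc := plaq`, `hregLoc := hreg` of
`lowEnvelope_of_cor3With_reading₂` (consistency of §5 with §6; definitional). [folklore] -/
theorem lowEnvelope_of_cor3With_reading₂_self (D : FiniteEpsData F G) (hsign : B16.SignConventions D.C)
    {γB γ g : ℝ} {em ep : ℝ → ℝ} {g₀ : ℕ → ℝ} (hcor : B16.Cor3With D.C γB em ep) (hγ : γ ≤ γB)
    (htuned : D.Tuned γ g g₀) (κ : ℕ → ℕ)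
    {obs : (K : ℕ) → GaugeField (F.P K) 0 G → ℝ} {B l₀ : ℝ}
    (hobs : ∀ K, Measurable (obs K)) (hbd : ∀ K U, |obs K U| ≤ B)
    {ι : Type*} {T : ℕ → Finset ι} {A : ℕ → ℝ → ι → ℝ} {K₀ : ℕ}
    (hα : ∀ K t, |t| ≤ l₀ → K₀ ≤ K →
      ∫ U, Real.exp (t * obs (κ K) U) * D.dens (κ K) (g₀ (κ K)) 0 U ∂fieldMeasure (F.P (κ K)) 0 G ≤
        ∑ τ ∈ T K, A K t τ)
    {Bset : Set G} (hB : MeasurableSet Bset) (hθ : 0 < (HaarData.haar (G := G)).real Bset)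
    {Fine : ℕ → Type*} [∀ K, Fintype (Fine K)] (plaq : (K : ℕ) → GaugeField (F.P (κ K)) (κ K) G → Fine K → G)
    {εK η : ℕ → ℝ} {B₃ ε₁ cG n4 n₁ : ℝ}
    (hchi : ∀ K, K₀ ≤ K → ∀ V, (∀ p, dist1 (plaq K V p) < εK K * η K ^ 2) →
      (D.C ⟨κ K, F.m, g₀ (κ K)⟩).χ (κ K) ((D.real.cfg (κ K) (g₀ (κ K)) (κ K)).symm V) = 1)
    (hwil : ∀ K, K₀ ≤ K → ∀ V, (D.C ⟨κ K, F.m, g₀ (κ K)⟩).wilsonBG (κ K) ((D.real.cfg (κ K) (g₀ (κ K)) (κ K)).symm V) =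
      ∑ p, (1 - reTr (plaq K V p)))
    (hG : ∀ h : G, 1 - reTr h ≤ cG * dist1 h ^ 2) (hcG : 0 ≤ cG)
    (hcount : ∀ K, K₀ ≤ K → (Fintype.card (Fine K) : ℝ) * η K ^ 4 ≤ n4)
    (hreg : ∀ K, K₀ ≤ K → ∀ V : GaugeField (F.P (κ K)) (κ K) G, (∀ b, V b ∈ Bset) →
      ∀ p, dist1 (plaq K V p) < B₃ * ε₁ * η K ^ 2)
    (hε : ∀ K, K₀ ≤ K → B₃ * ε₁ ≤ εK K)
    (hsites : ∀ K, K₀ ≤ K → ((D.C ⟨κ K, F.m, g₀ (κ K)⟩).numSites (κ K) : ℝ) ≤ n₁)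
    {nup : ℕ → ℝ → ℝ} {Nup : ℝ} (hnup : ∀ K t, |t| ≤ l₀ → K₀ ≤ K → 0 ≤ nup K t ∧ nup K t ≤ Nup) :
    LowEnvelope l₀ T A
      (nlowOf l₀ B (max (em g) 0) n₁
        (floorOf g (cG * (B₃ * ε₁) ^ 2 * n4) ((HaarData.haar (G := G)).real Bset ^ unitBondCount F))) nup
      (constOf l₀ B (max (em g) 0) n₁
        (floorOf g (cG * (B₃ * ε₁) ^ 2 * n4) ((HaarData.haar (G := G)).real Bset ^ unitBondCount F)) Nup) K₀ :=
  lowEnvelope_of_cor3With_reading₂ D hsign hcor hγ htuned κ hobs hbd hα hB hθ plaq plaq hchi hwil hG hcG hcount hreg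
    hreg hε hsites hnup

end TwoFamilies

end Literature.MathematicalPhysics.QuantumFieldTheory.Balaban1983to89.T4StabilityFloor
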